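import Summits.BirchSwinnertonDyer.BirchSwinnertonDyer.Theorems.PublishedInputsGreenbergLocalSurjectivityAtP
import Summits.BirchSwinnertonDyer.Rank1Residual.Additive.LocalZpExtension
import HarnessLib

/-!
# Route `ByReductionTypeAtTwo` (K4), TOWER road — `(Ê(𝔪_{∞,η}) ⊗ ℚ_p/ℤ_p)_Γ = 0` at a good ordinary `v ∣ p` over `ℚ`
# with witnesses IN THE FORMAL GROUP, for a PRESCRIBED topological generator (Coates–Greenberg + `H²(ℚ_v, Ê[p^∞]) = 0`)

Cell `bsd-2adic`, seat `bsd-2adic-tower-1` (GEN 25), `--supports stmt-BirchSwinnertonDyer-19271` (helper). TOOL theorems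
only (no definition, no named fact, no `sorry`); closes nothing by itself; BSD is not proved by any of this. Part (b₁) of the
programme «Greenberg LNM 1716 Lemma 3.4 at layer `0` EXACT ⇒ Thm. 4.1 over `ℚ` ⇒ the `hEC` binder of the TOWER doors in the
kernel» (siblings `…EulerCharLayerZero.lean`, `…EulerCharCoinvExact.lean`, `…EulerCharDevissage.lean`).

Exactness on `p`-power torsion of the dévissage `0 → M₁/(g−1)M₁ → M/(g−1)M → Ẽ(𝔽_p) → 0` (`M = E(K̄_v)^{H_∞}`,
`M₁ = M ∩ Ê(𝔪̄)`) needs `(M₁ ⊗ ℚ_p/ℤ_p)_Γ = 0` element-wise WITH WITNESSES IN `M₁`. Cell bsd-inputs (k4-p1 g4,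
`InputsGreenbergLocalAtP.coinvInput_of_mem_ker`) derived it from `H²(K_v, Ê[p^∞]) = 0` and the Coates–Greenberg vanishing
`H¹(H_∞, Ê(𝔪̄)) = 0` (`H1_goodModelKernel_trivial_holds`), recording only `m, R ∈ M`; §1 re-runs that proof keeping
`m, R ∈ Ê(𝔪̄)`, §3 assembles it over `ℚ` at a good ordinary `v ∣ p` as in `exists_primary_resOfLe_eq_of_forall_conjH1_eq_atP`,
§4 supplies the local `ℤ_p`-extension with a PRESCRIBED topological generator (b2b's `exists_localZpExtension`, unit twist).

* §1 `coinvInput_of_mem_ker_ker` (any number field, abstract `red₀`-currency); §3 `coinvInput_ker_atP` (over `ℚ`, good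
  ordinary `v ∣ p`, any `g` generating a local `ℤ_p`-extension with kernel `H_∞`); §4
  `exists_zpExtension_kerSubgroup_eq_isTopGenerator` (a local `ℤ_p`-extension with kernel `H_{E,∞}` and prescribed generator).
References: [GreenbergLNM1716] §2 Props. 2.1–2.4 (pp. 70–75), §3 p. 87, §4 p. 108; [CoatesGreenberg1996] Cor. 3.2, Prop. 4.3;
[Washington1997] §13.1.
-/

set_option autoImplicit false
-- justification: the mandated namespace `Summit.BirchSwinnertonDyer.BirchSwinnertonDyer.Theorems`
-- (single-conjunct summit, Sub = Summit) repeats a segment by design (D-0017).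
set_option linter.dupNamespace false

noncomputable section

open scoped Classical NNReal

universe u

namespace Summit.BirchSwinnertonDyer.BirchSwinnertonDyer.Theorems.GoodOrdTower

open CategoryTheory NumberField IsDedekindDomain Field _root_.TopRep _root_.ContinuousCohomology WeierstrassCurve
  Literature.NumberTheory.GaloisRepresentations Literature.NumberTheory.EllipticCurves
  Literature.NumberTheory.EllipticCurves.ZpExtension IsDedekindDomain.HeightOneSpectrum
  Literature.NumberTheory.EllipticCurves.FormalGroupChart Literature.NumberTheory.EllipticCurves.ResKernel
  Literature.NumberTheory.EllipticCurves.Rank1Residual Literature.NumberTheory.EllipticCurves.CoatesGreenberg1996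
  Literature.NumberTheory.EllipticCurves.Greenberg1999
  Summit.BirchSwinnertonDyer.BirchSwinnertonDyer.Theorems.InputsGreenbergLocalAtP

/-! ## §1 (H²) on `M ∩ E₁` with witnesses in `E₁` -/

section CoinvKer
variable {K : Type u} [Field K] [NumberField K] (v : HeightOneSpectrum (𝓞 K)) (W : WeierstrassCurve K) [W.IsElliptic]
  {p : ℕ} [hp : Fact p.Prime]

omit [W.IsElliptic] in
set_option maxHeartbeats 1600000 in
/-- **`(Ê(𝔪_{∞,η}) ⊗ ℚ_p/ℤ_p)_{Γ_η} = 0`, element-wise, witnesses in `E₁`** — k4-p1's `coinvInput_of_mem_ker` re-run in its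
abstract `red₀`-currency (`hstab`, `hdiv₁`, `C = E₁ ∩ E(K̄_v)[p^∞]` with `ρ`, `hH2 : H²(Γ_{K_v}, C) = 0`, Coates–Greenberg `hCG`,
local `ℤ_p`-extension `κE` with generator `g`): for `N`-fixed `a ∈ E₁` and every `k` there are `j` and `N`-fixed `m, R ∈ E₁` with
`p^j a = (g m − m) + p^{k+j} R` (`m = p^K e`, `R = b + c₀ − (g e − e)`, `b, c₀, e ∈ E₁`).
[cite: GreenbergLNM1716, §2 Props. 2.2–2.4 (pp. 72–75) and §4 p. 108] [cite: CoatesGreenberg1996, Cor. 3.2 and Prop. 4.3] -/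
theorem coinvInput_of_mem_ker_ker (κE : ZpExtension (v.adicCompletion K) p)
    {g : absoluteGaloisGroup (v.adicCompletion K)} (hγ : κE.IsTopGenerator g)
    {B : Type*} [AddCommGroup B] (red₀ : localPoints W (v.adicCompletion K) →+ B)
    (hstab : ∀ (σ : absoluteGaloisGroup (v.adicCompletion K)) (Q : localPoints W (v.adicCompletion K)),
      red₀ Q = 0 → red₀ (σ • Q) = 0)
    (hdiv₁ : ∀ a : localPoints W (v.adicCompletion K), red₀ a = 0 →
      ∃ b : localPoints W (v.adicCompletion K), red₀ b = 0 ∧ p • b = a)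
    (C : AddSubgroup (localPoints W (v.adicCompletion K)))
    (hC : ∀ a, a ∈ C ↔ red₀ a = 0 ∧ ∃ e : ℕ, p ^ e • a = 0)
    (ρ : ContinuousRep (absoluteGaloisGroup (v.adicCompletion K)) ℤ C)
    (hρ : ∀ (σ : absoluteGaloisGroup (v.adicCompletion K)) (c : C),
      ((ρ σ c : C) : localPoints W (v.adicCompletion K)) = σ • (c : localPoints W (v.adicCompletion K)))
    (hH2 : Subsingleton (continuousCohomology 2 ρ.toTopRep))
    (hCG : ∀ ψ : contOneCocycles (discreteTopRep κE.kerSubgroup (localPoints W (v.adicCompletion K))),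
      (∀ τ, red₀ (ψ.1 τ) = 0) →
        ∃ e : localPoints W (v.adicCompletion K), red₀ e = 0 ∧
          ∀ τ : κE.kerSubgroup, ψ.1 τ = (τ : absoluteGaloisGroup (v.adicCompletion K)) • e - e)
    (a : localPoints W (v.adicCompletion K)) (ha0 : red₀ a = 0) (ha : ∀ τ ∈ κE.kerSubgroup, τ • a = a) (k : ℕ) :
    ∃ (j : ℕ) (m R : localPoints W (v.adicCompletion K)), red₀ m = 0 ∧ red₀ R = 0 ∧
      (∀ τ ∈ κE.kerSubgroup, τ • m = m) ∧ (∀ τ ∈ κE.kerSubgroup, τ • R = R) ∧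
      p ^ j • a = (g • m - m) + p ^ (k + j) • R := by
  -- notation and instances
  let E := v.adicCompletion K
  let Pt : Type u := localPoints W E
  let Γ := absoluteGaloisGroup E
  let N : Subgroup Γ := κE.kerSubgroup
  haveI : CompactSpace Γ := absoluteGaloisGroup_compactSpace E
  haveI : T2Space Γ := krullTopology_t2
  haveI hNc : IsClosed ((κE.kerSubgroup : Subgroup Γ) : Set Γ) := κE.isClosed_kerSubgroup
  haveI : CompactSpace κE.kerSubgroup := isCompact_iff_compactSpace.mp hNc.isCompact
  have galois_smul_nsmul : ∀ (τ : Γ) (n : ℕ) (P : Pt), τ • (n • P) = n • (τ • P) :=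
    fun τ n P ↦ map_nsmul (DistribSMul.toAddMonoidHom Pt τ) n P
  have hprim : IsPrimaryTorsion p C := fun c ↦ by
    obtain ⟨-, e, he⟩ := (hC c).mp c.2
    exact ⟨e, Subtype.ext (by rw [AddSubgroupClass.coe_nsmul, he, ZeroMemClass.coe_zero])⟩
  -- iterated `p`-divisibility of `E₁`
  have hdivpow : ∀ (i : ℕ) (x : Pt), red₀ x = 0 → ∃ y : Pt, red₀ y = 0 ∧ p ^ i • y = x := by
    intro i
    induction i with
    | zero => exact fun x hx ↦ ⟨x, hx, by rw [pow_zero, one_smul]⟩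
    | succ i ih =>
      intro x hx
      obtain ⟨y, hy, rfl⟩ := hdiv₁ x hx
      obtain ⟨z, hz, rfl⟩ := ih y hy
      exact ⟨z, hz, by rw [pow_succ, mul_comm, mul_smul]⟩
  -- `b ∈ E₁` with `p^k b = a`; the Kummer cocycle `s(τ) = τ b − b` with values in `C`
  obtain ⟨b, hb0, hba⟩ := hdivpow k a ha0
  have hsmem : ∀ τ : κE.kerSubgroup, (τ : Γ) • b - b ∈ C := fun τ ↦ by
    refine (hC _).mpr ⟨?_, k, ?_⟩
    · rw [map_sub, hstab _ b hb0, hb0, sub_zero]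
    · rw [smul_sub, ← galois_smul_nsmul, hba, ha τ τ.2, sub_self]
  have hscont : Continuous fun τ : κE.kerSubgroup ↦ (⟨(τ : Γ) • b - b, hsmem τ⟩ : C) :=
    ((continuous_of_discreteTopology (f := fun q : Pt ↦ q - b)).comp
      ((continuous_smul_localPoints W E b).comp continuous_subtype_val)).subtype_mk _
  have hρN : ∀ (τ : κE.kerSubgroup) (c : C),
      (((subgroupRep ρ.toTopRep κE.kerSubgroup).ρ τ c : C) : Pt) = (τ : Γ) • (c : Pt) := fun τ c ↦ hρ τ c
  let s : contOneCocycles (subgroupRep ρ.toTopRep κE.kerSubgroup) :=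
    ⟨⟨fun τ ↦ ⟨(τ : Γ) • b - b, hsmem τ⟩, hscont⟩, fun σ τ ↦ by
      apply Subtype.ext
      rw [AddSubgroup.coe_add, hρN]
      change ((σ : Γ) * (τ : Γ)) • b - b = ((σ : Γ) • b - b) + (σ : Γ) • ((τ : Γ) • b - b)
      rw [mul_smul, smul_sub]
      abel⟩
  have hs : ∀ τ : κE.kerSubgroup, ((s.1 τ : C) : Pt) = (τ : Γ) • b - b := fun _ ↦ rfl
  -- Hochschild–Serre: `[s] = g·[ψ] − [ψ]` in `H¹(N, C)`
  have hinj : ∀ x : continuousCohomology 2 ρ.toTopRep, resSubgroup ρ.toTopRep κE.kerSubgroup 2 x = 0 → x = 0 :=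
    fun x _ ↦ Subsingleton.elim _ _
  obtain ⟨tc, htc⟩ := exists_conjMap_sub_eq_of_resSubgroup_two_injective κE.toContinuousMonoidHom κE.kerSubgroup ρ
    κE.surjective (fun _ ↦ ZpExtension.mem_kerSubgroup) hγ (groupCdLE_one_quotient_kerSubgroup κE) hprim hinj
    (oneCocycleClass _ s)
  obtain ⟨ψ, rfl⟩ := oneCocycleClass_surjective _ tc
  rw [conjMap_oneCocycleClass, ← oneCocycleClass_sub, ← sub_eq_zero, ← oneCocycleClass_sub,
    oneCocycleClass_eq_zero_iff] at htc
  obtain ⟨c₀, hc₀⟩ := htc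
  have hc₀' : ∀ τ : κE.kerSubgroup,
      g • (((ψ.1 (subgroupConj κE.kerSubgroup g τ) : C) : Pt)) - ((ψ.1 τ : C) : Pt) - ((τ : Γ) • b - b) =
        (τ : Γ) • (c₀ : Pt) - c₀ := by
    intro τ
    have h := congrArg (fun x : C ↦ (x : Pt)) (hc₀ τ)
    simp only [ContinuousMap.sub_apply, AddSubgroupClass.coe_sub] at h
    rw [hρN, hs] at h
    rw [← hρ]
    exact h
  -- a uniform exponent killing `ψ` and `c₀`
  obtain ⟨Nψ, hNψ⟩ := exists_pow_smul_apply_eq_zero (p := p) ψ.1 (fun τ ↦ hprim _)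
  obtain ⟨e₀, he₀⟩ := hprim c₀
  -- Coates–Greenberg: `ψ = ∂e` with `e ∈ E₁`
  let ψ' : contOneCocycles (discreteTopRep κE.kerSubgroup Pt) :=
    ⟨⟨fun τ ↦ ((ψ.1 τ : C) : Pt), continuous_subtype_val.comp ψ.1.continuous⟩, fun σ τ ↦ by
      change ((ψ.1 (σ * τ) : C) : Pt) = ((ψ.1 σ : C) : Pt) + (σ : Γ) • ((ψ.1 τ : C) : Pt)
      rw [ψ.2 σ τ, AddSubgroup.coe_add, hρN]⟩
  have hψ' : ∀ τ, ψ'.1 τ = ((ψ.1 τ : C) : Pt) := fun _ ↦ rfl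
  obtain ⟨e, he0, he⟩ := hCG ψ' (fun τ ↦ ((hC _).mp (ψ.1 τ).2).1)
  -- `R' = b + c₀ − (g e − e)` is fixed by `N`
  have hconj_smul : ∀ τ : κE.kerSubgroup, g • (((subgroupConj κE.kerSubgroup g τ : κE.kerSubgroup) : Γ) • e) =
      (τ : Γ) • g • e := fun τ ↦ by
    rw [subgroupConj_apply_coe, ← mul_smul, ← mul_smul, ← mul_assoc, ← mul_assoc, mul_inv_cancel, one_mul]
  have hR' : ∀ τ ∈ κE.kerSubgroup, τ • (b + (c₀ : Pt) - (g • e - e)) = b + (c₀ : Pt) - (g • e - e) := by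
    intro τ hτ
    have h := hc₀' ⟨τ, hτ⟩
    rw [← hψ', ← hψ', he, he, smul_sub g, hconj_smul] at h
    rw [← sub_eq_zero]
    rw [← sub_eq_zero] at h
    rw [smul_sub τ, smul_add τ, smul_sub τ]
    change τ • g • e - g • e - (τ • e - e) - (τ • b - b) - (τ • (c₀ : Pt) - c₀) = 0 at h
    calc τ • b + τ • (c₀ : Pt) - (τ • g • e - τ • e) - (b + (c₀ : Pt) - (g • e - e))
        = -(τ • g • e - g • e - (τ • e - e) - (τ • b - b) - (τ • (c₀ : Pt) - c₀)) := by abel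
      _ = 0 := by rw [h, neg_zero]
  -- `m = p^K e` is fixed by `N` for `K = k + (Nψ + e₀)`
  have hm : ∀ τ ∈ κE.kerSubgroup, τ • ((p ^ (k + (Nψ + e₀))) • e) = (p ^ (k + (Nψ + e₀))) • e := by
    intro τ hτ
    have h1 : p ^ Nψ • (τ • e - e) = 0 := by
      have h := congrArg (fun x : C ↦ (x : Pt)) (hNψ ⟨τ, hτ⟩)
      simp only [AddSubgroupClass.coe_nsmul, ZeroMemClass.coe_zero] at h
      rw [← hψ', he] at h
      exact h
    rw [galois_smul_nsmul, ← sub_eq_zero, ← smul_sub, show k + (Nψ + e₀) = (k + e₀) + Nψ by ring, pow_add,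
      mul_smul, h1, smul_zero]
  refine ⟨Nψ + e₀, (p ^ (k + (Nψ + e₀))) • e, b + (c₀ : Pt) - (g • e - e), ?_, ?_, hm, hR', ?_⟩
  · rw [map_nsmul, he0, smul_zero]
  · rw [map_sub, map_add, map_sub, hb0, ((hC _).mp c₀.2).1, hstab g e he0, he0, zero_add, sub_zero, sub_zero]
  -- multiply `R'` by `p^(k + Nψ + e₀)`
  have h1 : p ^ (k + (Nψ + e₀)) • b = p ^ (Nψ + e₀) • a := by
    rw [pow_add, mul_comm, mul_smul, hba]
  have h2 : p ^ (k + (Nψ + e₀)) • (c₀ : Pt) = 0 := by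
    rw [show k + (Nψ + e₀) = (k + Nψ) + e₀ by ring, pow_add, mul_smul, ← AddSubgroupClass.coe_nsmul, he₀,
      ZeroMemClass.coe_zero, smul_zero]
  rw [smul_sub (p ^ (k + (Nψ + e₀))), smul_add (p ^ (k + (Nψ + e₀))), h1, h2, add_zero,
    smul_sub (p ^ (k + (Nψ + e₀))), galois_smul_nsmul]
  abel

end CoinvKer
/-! ## §3 (H²) on `M ∩ E₁` over `ℚ` at a good ordinary `v ∣ p` (k4-p1's assembly, witnesses in `E₁`) -/

section AtP

variable {p : ℕ} [hp : Fact p.Prime]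

set_option maxHeartbeats 3200000 in
/-- **`(Ê(𝔪_{∞,η}) ⊗ ℚ_p/ℤ_p)_Γ = 0` over `ℚ` at a good ORDINARY `v ∣ p`, element-wise, witnesses in `E₁`.** For `W/ℚ`
globally minimal and elliptic with `GoodOrd W p`, `κ` the cyclotomic `ℤ_p`-extension, `v ∋ p`, the spectral valuation `w`
and the reduction map `red₀` of the good model `W_ℤ ⊗ 𝒪_w` (`hred₀`), and any `g` which is a topological generator of some
local `ℤ_p`-extension of `ℚ_v` with kernel `H_∞` (`hg`): every `H_∞`-fixed `a ∈ E₁ = ker red₀` satisfies, for every `k`,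
`p^j a = (g m − m) + p^{k+j} R` with `H_∞`-fixed `m, R ∈ E₁`. Assembly verbatim from cell bsd-inputs'
`InputsGreenbergLocalAtP.exists_primary_resOfLe_eq_of_forall_conjH1_eq_atP` (ordinary `red₀`-package, `H²(ℚ_v, C) = 0` by
`subsingleton_continuousCohomology_two_formalTorsion`, Coates–Greenberg by `H1_goodModelKernel_trivial_holds`) feeding §1.
[cite: GreenbergLNM1716, §2 Props. 2.1–2.4 (pp. 70–75), §4 p. 108] [cite: CoatesGreenberg1996, Cor. 3.2 and Prop. 4.3] -/
theorem coinvInput_ker_atP (W : WeierstrassCurve ℚ) [W.IsGloballyMinimal] [W.IsElliptic] (hgo : GoodOrd W p)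
    (κ : ZpExtension ℚ p) (hκ : κ.IsCyclotomic) (v : HeightOneSpectrum (𝓞 ℚ)) (hpv : ((p : ℕ) : 𝓞 ℚ) ∈ v.asIdeal)
    {w : Valuation (AlgebraicClosure (v.adicCompletion ℚ)) ℝ≥0}
    (hw : ∀ x, (w x : ℝ) = spectralNorm (v.adicCompletion ℚ) (AlgebraicClosure (v.adicCompletion ℚ)) x)
    (red₀ : localPoints W (v.adicCompletion ℚ) →+
      (((integralModelInt W).map (algebraMap ℤ ↥w.valuationSubring)).map
        (IsLocalRing.residue ↥w.valuationSubring)).toAffine.Point)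
    (hred₀ : ∀ P : localPoints W (v.adicCompletion ℚ), red₀ P =
      ((integralModelInt W).map (algebraMap ℤ ↥w.valuationSubring)).reducePoint
        (Affine.Point.congrEquiv (localIntModel_baseChange W w.valuationSubring).symm P))
    {g : absoluteGaloisGroup (v.adicCompletion ℚ)}
    (hg : ∃ κE : ZpExtension (v.adicCompletion ℚ) p,
      κE.kerSubgroup = localSubgroup κ.kerSubgroup (v.adicCompletion ℚ) ∧ κE.IsTopGenerator g) :
    ∀ a : localPoints W (v.adicCompletion ℚ), red₀ a = 0 →
      (∀ τ ∈ localSubgroup κ.kerSubgroup (v.adicCompletion ℚ), τ • a = a) → ∀ k : ℕ,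
      ∃ (j : ℕ) (m R : localPoints W (v.adicCompletion ℚ)), red₀ m = 0 ∧ red₀ R = 0 ∧
        (∀ τ ∈ localSubgroup κ.kerSubgroup (v.adicCompletion ℚ), τ • m = m) ∧
        (∀ τ ∈ localSubgroup κ.kerSubgroup (v.adicCompletion ℚ), τ • R = R) ∧
        p ^ j • a = (g • m - m) + p ^ (k + j) • R := by
  let K := v.adicCompletion ℚ
  let Pt : Type := localPoints W K
  let Γ := absoluteGaloisGroup K
  let Hi : Subgroup Γ := localSubgroup κ.kerSubgroup K
  haveI : CompactSpace Γ := absoluteGaloisGroup_compactSpace K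
  have galois_smul_nsmul : ∀ (τ : Γ) (n : ℕ) (P : Pt), τ • (n • P) = n • (τ • P) :=
    fun τ n P ↦ map_nsmul (DistribSMul.toAddMonoidHom Pt τ) n P
  -- the local data at `v ∣ p` (as in `GoodOrdTower.exists_natCard_localTowerKerPrimary_le_of_localEP`)
  have hord : W.HasGoodReductionAtPrime p ∧ ¬ ((p : ℕ) : ℤ) ∣ W.frobeniusTrace p := hgo
  have hΔ : ¬ ((p : ℕ) : ℤ) ∣ minimalDiscriminantInt W :=
    W.not_dvd_minimalDiscriminantInt_of_hasGoodReductionAtPrime' p hord.1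
  have hap := hord.2
  have hvO : w.Integers w.valuationSubring := Valuation.valuationSubring.integers w
  have hΔu := W.isUnit_Δ_localIntModel hpv hw hΔ
  have hpO : w ((p : ℕ) : AlgebraicClosure K) < 1 := by
    have h := spectralValuation_algebraMap_ringOfIntegers_lt_one (v := v) hw hpv
    rwa [map_natCast] at h
  haveI hchar : CharP (IsLocalRing.ResidueField ↥w.valuationSubring) p := by
    refine (CharP.charP_iff_prime_eq_zero hp.out).mpr ?_
    rw [← map_natCast (IsLocalRing.residue ↥w.valuationSubring), IsLocalRing.residue_eq_zero_iff,
      IsLocalRing.mem_maximalIdeal, mem_nonunits_iff, hvO.isUnit_iff_valuation_eq_one, map_natCast]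
    exact ne_of_lt hpO
  -- the Frobenius inside `H_∞`, the ordinary filtration, the finite set `SF`
  obtain ⟨𝔐, h𝔐⟩ := v.localPrimesAbove_nonempty
  have hϖ : Irreducible ((p : ℕ) : v.adicCompletionIntegers ℚ) := irreducible_natCast_adicCompletionIntegers_rat hpv
  obtain ⟨τ, hτ, hτfix⟩ := exists_isArithFrobAt_forall_smul_eq hw h𝔐 hpv hϖ
  have hτHi : τ ∈ Hi :=
    (mem_localSubgroup_iff _ _ τ).mpr (resGal_mem_kerSubgroup_of_forall_smul_rootOfUnity_eq hκ hτfix)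
  have hordA := W.exists_zsmul_eq_zero_localRed_ne_zero hw hΔu red₀ hred₀ hpv hΔ hap
  obtain ⟨hgenr, hsurj, hdiv₁⟩ := W.localRed_ordinary_filtration hΔu red₀ hred₀ hordA
  obtain ⟨SF, hSF⟩ := W.exists_finset_localRed_smul_frobenius hw hΔu red₀ hred₀ h𝔐 hτ
  have hstab : ∀ (σ : Γ) (Q : Pt), red₀ Q = 0 → red₀ (σ • Q) = 0 :=
    fun σ Q hQ ↦ (W.localRed_smul_eq_zero_iff hw hΔu red₀ hred₀ σ Q).mpr hQ
  have htor : ∀ P : Pt, ∃ n : ℕ, 0 < n ∧ red₀ (n • P) = 0 := fun P ↦ W.exists_nsmul_localRed_eq_zero hw red₀ P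
  -- the subgroup `C = E₁ ∩ E(K̄_v)[p^∞]` and the Galois representation on it
  let C : AddSubgroup Pt := red₀.ker ⊓ AddCommGroup.primaryComponent Pt p
  have hC : ∀ a : Pt, a ∈ C ↔ red₀ a = 0 ∧ ∃ e : ℕ, p ^ e • a = 0 := fun a ↦ by
    change a ∈ red₀.ker ⊓ AddCommGroup.primaryComponent Pt p ↔ _
    rw [AddSubgroup.mem_inf, AddMonoidHom.mem_ker, AddCommGroup.mem_primaryComponent]
  have hCstab : ∀ (σ : Γ) (a : Pt), a ∈ C → σ • a ∈ C := fun σ a ha ↦ by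
    obtain ⟨ha0, e, he⟩ := (hC a).mp ha
    exact (hC _).mpr ⟨hstab σ a ha0, e, by rw [← galois_smul_nsmul, he, smul_zero]⟩
  letI iSMul : SMul Γ C := ⟨fun σ z ↦ ⟨σ • (z : Pt), hCstab σ z z.2⟩⟩
  have hsmul : ∀ (σ : Γ) (z : C), ((σ • z : C) : Pt) = σ • (z : Pt) := fun _ _ ↦ rfl
  letI iMA : MulAction Γ C :=
    { one_smul := fun z ↦ Subtype.ext (by rw [hsmul, one_smul])
      mul_smul := fun σ σ' z ↦ Subtype.ext (by rw [hsmul, hsmul, hsmul, mul_smul]) }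
  letI iDMA : DistribMulAction Γ C :=
    { smul_zero := fun σ ↦ Subtype.ext (by rw [hsmul, ZeroMemClass.coe_zero, smul_zero])
      smul_add := fun σ z z' ↦ Subtype.ext (by
        rw [hsmul, AddMemClass.coe_add, AddMemClass.coe_add, hsmul, hsmul, smul_add]) }
  let ρ : ContinuousRep Γ ℤ C :=
    ContinuousRep.ofStabilizerMemNhdsOne (Representation.ofDistribMulAction ℤ Γ C) fun z ↦ by
      have hopen' : IsOpen ((fun σ : Γ ↦ σ • (z : Pt)) ⁻¹' {(z : Pt)}) :=
        (isOpen_discrete _).preimage (continuous_smul_localPoints W K (z : Pt))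
      refine Filter.mem_of_superset (hopen'.mem_nhds (by simp)) fun σ hσ ↦ ?_
      exact Subtype.ext hσ
  have hρ : ∀ (σ : Γ) (z : C), ((ρ σ z : C) : Pt) = σ • (z : Pt) := fun _ _ ↦ rfl
  -- step 1: `H²(ℚ_v, C) = 0`
  have hH2 : Subsingleton (continuousCohomology 2 ρ.toTopRep) :=
    subsingleton_continuousCohomology_two_formalTorsion v W red₀ hstab hdiv₁ hgenr hsurj hτfix SF hSF C hC ρ hρ
  -- the Coates–Greenberg vanishing for the good model `W_ℤ ⊗ 𝒪_w` (`C = 1`), in `red₀`-currency on `H_∞`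
  let W₀ : WeierstrassCurve w.integer := (integralModelInt W).map (algebraMap ℤ ↥w.valuationSubring)
  have hΔ' : IsUnit W₀.Δ := hΔu
  have e₁ : W₀.baseChange (AlgebraicClosure K) = W.baseChange (AlgebraicClosure K) :=
    localIntModel_baseChange W w.valuationSubring
  have hW₀ : (1 : VariableChange (AlgebraicClosure K)) • (W.baseChange K).baseChange (AlgebraicClosure K) =
      W₀.baseChange (AlgebraicClosure K) := by
    rw [one_smul, baseChange_baseChange_adicCompletion, e₁]
  have hred : ∀ P : Pt, red₀ P = goodReductionHom W₀ (Valuation.integer.integers w) hΔ'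
      (Affine.Point.congrEquiv hW₀ (VariableChange.pointEquiv _ 1
        (Affine.Point.congrEquiv (baseChange_baseChange_adicCompletion W v).symm P))) := by
    intro P
    rw [hred₀ P, goodReductionHom_apply]
    congr 1
    change (W.baseChange (AlgebraicClosure K)).toAffine.Point at P
    rcases P with _ | ⟨x, y, hP⟩
    · simp only [← Affine.Point.zero_def, map_zero]
      rfl
    · simp only [Affine.Point.congrEquiv_some, VariableChange.pointEquiv_some]
      exact point_some_congr (toX_one x).symm (toY_one x y).symm
  have hmem1 : ∀ P : Pt, red₀ P = 0 → Affine.Point.congrEquiv hW₀ (VariableChange.pointEquiv _ 1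
      (Affine.Point.congrEquiv (baseChange_baseChange_adicCompletion W v).symm P)) ∈
        kernelOfReduction W₀ (Valuation.integer.integers w) := fun P hP ↦ by
    rw [mem_kernelOfReduction_iff, ← goodReductionHom_eq_zero_iff (Valuation.integer.integers w) hΔ', ← hred]
    exact hP
  have hmem2 : ∀ P : Pt, Affine.Point.congrEquiv hW₀ (VariableChange.pointEquiv _ 1
      (Affine.Point.congrEquiv (baseChange_baseChange_adicCompletion W v).symm P)) ∈
        kernelOfReduction W₀ (Valuation.integer.integers w) → red₀ P = 0 := fun P hP ↦ by
    rw [mem_kernelOfReduction_iff, ← goodReductionHom_eq_zero_iff (Valuation.integer.integers w) hΔ', ← hred] at hP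
    exact hP
  have hGc : IsClosed ((Hi : Set Γ)) := κ.isClosed_kerSubgroup.preimage (map_continuous (resGal (K := ℚ) K))
  have hGC : ∀ σ ∈ Hi, (1 : VariableChange (AlgebraicClosure K)).map
      ((absoluteGaloisGroup.toAlgEquiv K σ : AlgebraicClosure K ≃ₐ[K] AlgebraicClosure K) :
        AlgebraicClosure K →+* AlgebraicClosure K) = 1 :=
    fun σ _ ↦ (VariableChange.mapHom _).map_one
  have hCG_Hi : ∀ ψ : contOneCocycles (discreteTopRep Hi Pt), (∀ g, red₀ (ψ.1 g) = 0) →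
      ∃ e : Pt, red₀ e = 0 ∧ ∀ g : Hi, ψ.1 g = (g : Γ) • e - e := by
    intro ψ hψ
    obtain ⟨e, he, hφe⟩ := H1_goodModelKernel_trivial_holds ℚ W p κ hκ v hpv w hw 1 W₀ hW₀ hΔ' Hi hGc le_rfl hGC ψ
      (fun g ↦ hmem1 _ (hψ g))
    exact ⟨e, hmem2 e he, fun g ↦ hφe g⟩
  -- (H²) on `M ∩ E₁` for the given generator
  intro a ha0 ha k
  obtain ⟨κE, hker, hγ⟩ := hg
  have hkerι : ∀ σ : Γ, σ ∈ κE.kerSubgroup ↔ σ ∈ Hi := fun σ ↦ by rw [hker]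
  have hle : Hi ≤ κE.kerSubgroup := hker.ge
  have hCG : ∀ ψ : contOneCocycles (discreteTopRep κE.kerSubgroup Pt), (∀ σ, red₀ (ψ.1 σ) = 0) →
      ∃ e : Pt, red₀ e = 0 ∧ ∀ σ : κE.kerSubgroup, ψ.1 σ = (σ : Γ) • e - e := by
    intro ψ hψ
    let ψ' : contOneCocycles (discreteTopRep Hi Pt) := contOneCocycles.pullback (subgroupInclusion hle)
      (resHomOfEquivariant (subgroupInclusion hle) (AddMonoidHom.id Pt) (fun _ _ ↦ rfl)) ψ
    have hψ' : ∀ g : Hi, ψ'.1 g = ψ.1 (subgroupInclusion hle g) := fun _ ↦ rfl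
    obtain ⟨e, he0, he⟩ := hCG_Hi ψ' (fun g ↦ by rw [hψ']; exact hψ _)
    refine ⟨e, he0, fun σ ↦ ?_⟩
    have h := he ⟨(σ : Γ), (hkerι σ).mp σ.2⟩
    rw [hψ'] at h
    exact h
  have ha' : ∀ σ ∈ κE.kerSubgroup, σ • a = a := fun σ hσ ↦ ha σ ((hkerι σ).mp hσ)
  obtain ⟨j, m, R, hm0, hR0, hm, hR, heq⟩ := coinvInput_of_mem_ker_ker v W κE hγ red₀ hstab hdiv₁
    C hC ρ hρ hH2 hCG a ha0 ha' k
  exact ⟨j, m, R, hm0, hR0, fun σ hσ ↦ hm σ ((hkerι σ).mpr hσ), fun σ hσ ↦ hR σ ((hkerι σ).mpr hσ), heq⟩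

end AtP
/-! ## §4 A local `ℤ_p`-extension with a PRESCRIBED topological generator -/

section Generator

variable {K : Type u} [Field K] {p : ℕ} [hp : Fact p.Prime] (κ : ZpExtension K p)
  (E : Type u) [Field E] [Algebra K E]

/-- **Any `g` generating `Γ_E` topologically with `H_{E,∞}` is THE generator of a local `ℤ_p`-extension with kernel `H_{E,∞}`**
(`E` not split in `K_∞/K`): b2b's `exists_localZpExtension` gives `κ_E` with `ker κ_E = H_{E,∞}`; `κ_E(g)` is a unit (else the
open subgroup `κ_E⁻¹(pℤ_p) ⊇ H_{E,∞} ∪ {g}` is everything, contradicting surjectivity); twist by its inverse (`unitTwist`).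
[cite: GreenbergLNM1716, §3 p. 87] [cite: Washington1997, §13.1] -/
theorem exists_zpExtension_kerSubgroup_eq_isTopGenerator
    (hE : ∃ δ : Field.absoluteGaloisGroup E, resGal (K := K) E δ ∉ κ.kerSubgroup)
    {g : Field.absoluteGaloisGroup E}
    (hgen : ∀ U : Subgroup (Field.absoluteGaloisGroup E),
      IsOpen (U : Set (Field.absoluteGaloisGroup E)) → localSubgroup κ.kerSubgroup E ≤ U →
        g ∈ U → localSubgroup (κ.layerSubgroup 0) E ≤ U) :
    ∃ κE : ZpExtension E p, κE.kerSubgroup = localSubgroup κ.kerSubgroup E ∧ κE.IsTopGenerator g := by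
  obtain ⟨κE, -, hker, -, -⟩ := Rank1Residual.Additive.exists_localZpExtension κ E hE
  -- `κE g` is a unit
  have hmem0 : ∀ σ : Field.absoluteGaloisGroup E, σ ∈ localSubgroup (κ.layerSubgroup 0) E := fun σ ↦ by
    rw [mem_localSubgroup_iff, layerSubgroup_zero]; exact Subgroup.mem_top _
  have hunit : IsUnit (κE g).toAdd := by
    by_contra hnu
    have hdvd : (p : ℤ_[p]) ∣ (κE g).toAdd := by
      rw [← PadicInt.norm_lt_one_iff_dvd]
      exact lt_of_le_of_ne (PadicInt.norm_le_one _) (fun h ↦ hnu (PadicInt.isUnit_iff.mpr h))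
    have hg1 : g ∈ κE.layerSubgroup 1 := by rw [mem_layerSubgroup, pow_one]; exact hdvd
    have hle := hgen (κE.layerSubgroup 1) (κE.isOpen_layerSubgroup 1)
      (fun τ hτ ↦ κE.kerSubgroup_le_layerSubgroup 1 (by rw [hker]; exact hτ)) hg1
    obtain ⟨σ, hσ⟩ := κE.surjective (Multiplicative.ofAdd 1)
    have h1 : (p : ℤ_[p]) ^ 1 ∣ (κE σ).toAdd := mem_layerSubgroup.mp (hle (hmem0 σ))
    rw [pow_one, show (κE σ) = Multiplicative.ofAdd 1 from hσ, toAdd_ofAdd] at h1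
    exact hp.out.ne_one (by
      have h := PadicInt.isUnit_iff.mp (isUnit_of_dvd_one h1)
      have h2 := (PadicInt.norm_lt_one_iff_dvd (p : ℤ_[p])).mpr (dvd_refl _)
      rw [h] at h2
      exact absurd h2 (lt_irrefl _))
  obtain ⟨u, hu⟩ := hunit
  refine ⟨κE.unitTwist u⁻¹, by rw [kerSubgroup_unitTwist, hker], ?_⟩
  change κE.unitTwist u⁻¹ g = Multiplicative.ofAdd 1
  rw [unitTwist_apply, ← hu, Units.inv_mul]

end Generator

end Summit.BirchSwinnertonDyer.BirchSwinnertonDyer.Theorems.GoodOrdTower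

end
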